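import Summits.ValiantsHypothesis.ValiantsHypothesis.Theorems.DetQPDetqpThesisHyperdetCalibrationHigh
import Summits.ValiantsHypothesis.ValiantsHypothesis.Theorems.DetQPDetqpThesisTransfer
import Summits.ValiantsHypothesis.ValiantsHypothesis.Theorems.DetqpThesis.Negative.IffPerNotVQP
import Summits.ValiantsHypothesis.ValiantsHypothesis.Theorems.BorderApolarityGctBridge
import Summits.ValiantsHypothesis.ValiantsHypothesis.Theses.GCTMult

/-!
# Lead c3 calibration check — crux stmt-ValiantsHypothesis-0315 (`DetQP.DetqpThesis`)

Kernel re-confirmation (this seat, against the CURRENT tree, no `sorry`) of the four landed facts on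
which the line verdicts of lead c3 rest.  Nothing here is new mathematics; every proof term is a
landed tree declaration.

1. `c2_iff_gct`   : the ONLY open stub of line `four-dimensional-determinant` (skeleton v4,
   `stub_noFixedWitnessQP_high`, statement verbatim) ↔ `GCTMult.GctThesis` (crux stmt-0323, open).
2. `sketch_iff_x` : the ONLY open stub of line `Sketch` (`stub_hyperdet_not_qp`, verbatim) ↔ the crux.
3. `x_iff_evh`    : the crux ↔ `ExtendedValiantHypothesis ℂ` (tree def `¬ (VNP ℂ ⊆ VQP ℂ)`).
4. `gct_imp_x`    : `GctThesis → DetqpThesis` (the bridge is in the tree; 0323 is STRONGER than 0315).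
-/

open MvPolynomial
open scoped BigOperators Matrix
open Literature.Computability.AlgebraicComplexity
open Summit.ValiantsHypothesis.ValiantsHypothesis.Theses

namespace Summit.ValiantsHypothesis.ValiantsHypothesis.Cruxes.DetqpThesis.LeadC3

/-- (1) Registered stub C₂ of line `four-dimensional-determinant` ⇔ crux 0323. -/
theorem c2_iff_gct :
    (∀ c : ℕ, ∃ n₀ : ℕ, ∀ n ≥ n₀, ∀ (m : ℕ) [NeZero m], n ^ 4 ≤ 2 * m →
      m ≤ 2 ^ ((Nat.log 2 n + c) ^ c) →
      ∀ ι : (Fin 4 → Fin n) → Fin m × Fin m, Function.Injective ι →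
        ((0 : Fin m), (0 : Fin m)) ∉ Set.range ι →
        ¬ ∃ (P : ℕ → MvPolynomial (Fin m × Fin m) ℂ) (J : ℕ → Set (MvPolynomial (Fin m × Fin m) ℂ)),
          (∀ t : ℕ, P t ∈ glOrbit (Fin m × Fin m) ℂ (detPoly (Fin m) ℂ)) ∧
          IsBorderApolarLimit m P J ∧
          (∀ A : Matrix.GeneralLinearGroup (Fin m × Fin m) ℂ,
            let M : Matrix (Fin m × Fin m) (Fin m × Fin m) ℂ := A;
            (∃ a : Fin 4 → Matrix (Fin n) (Fin n) ℂ,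
                (∀ (r : Fin 4) (i j : Fin n), j < i → a r i j = 0) ∧
                (∀ I I' : Fin 4 → Fin n, M (ι I') (ι I) = ∏ r, a r (I' r) (I r)) ∧
                M (0, 0) (0, 0) ^ (m - n) * ∏ r, ∏ i, a r i i = 1) →
            (∀ (I : Fin 4 → Fin n) (p : Fin m × Fin m), p ∉ Set.range ι → M p (ι I) = 0) →
            (∀ p : Fin m × Fin m, p ≠ (0, 0) → M p (0, 0) = 0) →
            (∀ p q : Fin m × Fin m, p ∉ Set.range ι → p ≠ (0, 0) → q ∉ Set.range ι → q ≠ (0, 0) →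
                (p.1 : ℕ) * m + (p.2 : ℕ) < (q.1 : ℕ) * m + (q.2 : ℕ) → M q p = 0) →
            ∀ k ≤ m, ∀ D ∈ J k, linSubst (Fin m × Fin m) ℂ Mᵀ D ∈ J k) ∧
          (∀ k ≤ m, ∀ D ∈ J k, apolarAction D
            (X ((0 : Fin m), (0 : Fin m)) ^ (m - n) *
              rename ι (hyperdet fun I : Fin 4 → Fin n => (X I : MvPolynomial (Fin 4 → Fin n) ℂ))) = 0)) ↔
    GCTMult.GctThesis :=
  Summit.ValiantsHypothesis.ValiantsHypothesis.Theorems.DetQPDetqpThesis.HdCalibration.hd_noFixedWitnessQP_high_iff_gctThesis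

/-- (2) Registered stub of line `Sketch` (`X_H`) ⇔ the crux itself. -/
theorem sketch_iff_x :
    (¬ IsQPBounded (fun n => determinantalComplexity
      (hyperdet (fun I : Fin 4 → Fin n => (X I : MvPolynomial (Fin 4 → Fin n) ℂ))))) ↔
    DetQP.DetqpThesis :=
  Summit.ValiantsHypothesis.ValiantsHypothesis.Theorems.DetQPDetqpThesis.hyperdet_not_qp_iff_detqpThesis

/-- (3) The crux is the Extended Valiant Hypothesis over `ℂ` in the tree's vocabulary. -/
theorem x_iff_evh : DetQP.DetqpThesis ↔ ExtendedValiantHypothesis ℂ :=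
  Summit.ValiantsHypothesis.Theorems.DetqpThesis.Negative.detqpThesis_iff_extendedValiantHypothesis

/-- (4) Crux 0323 implies crux 0315 (bridge in tree). -/
theorem gct_imp_x : GCTMult.GctThesis → DetQP.DetqpThesis := fun h =>
  Summit.ValiantsHypothesis.ValiantsHypothesis.Theorems.BorderApolarityGctBridge.not_isQPBounded_dc_per_of_thesis h

/-- (1)+(4): the line closes the crux from its one open stub (sanity: the skeleton's composition
is not needed for this direction either). -/
theorem x_of_c2 (hC₂ : ∀ c : ℕ, ∃ n₀ : ℕ, ∀ n ≥ n₀, ∀ (m : ℕ) [NeZero m], n ^ 4 ≤ 2 * m →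
      m ≤ 2 ^ ((Nat.log 2 n + c) ^ c) →
      ∀ ι : (Fin 4 → Fin n) → Fin m × Fin m, Function.Injective ι →
        ((0 : Fin m), (0 : Fin m)) ∉ Set.range ι →
        ¬ ∃ (P : ℕ → MvPolynomial (Fin m × Fin m) ℂ) (J : ℕ → Set (MvPolynomial (Fin m × Fin m) ℂ)),
          (∀ t : ℕ, P t ∈ glOrbit (Fin m × Fin m) ℂ (detPoly (Fin m) ℂ)) ∧
          IsBorderApolarLimit m P J ∧
          (∀ A : Matrix.GeneralLinearGroup (Fin m × Fin m) ℂ,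
            let M : Matrix (Fin m × Fin m) (Fin m × Fin m) ℂ := A;
            (∃ a : Fin 4 → Matrix (Fin n) (Fin n) ℂ,
                (∀ (r : Fin 4) (i j : Fin n), j < i → a r i j = 0) ∧
                (∀ I I' : Fin 4 → Fin n, M (ι I') (ι I) = ∏ r, a r (I' r) (I r)) ∧
                M (0, 0) (0, 0) ^ (m - n) * ∏ r, ∏ i, a r i i = 1) →
            (∀ (I : Fin 4 → Fin n) (p : Fin m × Fin m), p ∉ Set.range ι → M p (ι I) = 0) →
            (∀ p : Fin m × Fin m, p ≠ (0, 0) → M p (0, 0) = 0) →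
            (∀ p q : Fin m × Fin m, p ∉ Set.range ι → p ≠ (0, 0) → q ∉ Set.range ι → q ≠ (0, 0) →
                (p.1 : ℕ) * m + (p.2 : ℕ) < (q.1 : ℕ) * m + (q.2 : ℕ) → M q p = 0) →
            ∀ k ≤ m, ∀ D ∈ J k, linSubst (Fin m × Fin m) ℂ Mᵀ D ∈ J k) ∧
          (∀ k ≤ m, ∀ D ∈ J k, apolarAction D
            (X ((0 : Fin m), (0 : Fin m)) ^ (m - n) *
              rename ι (hyperdet fun I : Fin 4 → Fin n => (X I : MvPolynomial (Fin 4 → Fin n) ℂ))) = 0)) :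
    DetQP.DetqpThesis :=
  gct_imp_x (c2_iff_gct.1 hC₂)

end Summit.ValiantsHypothesis.ValiantsHypothesis.Cruxes.DetqpThesis.LeadC3
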